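import Summits.KontsevichZagierPeriods.KontsevichZagierPeriods.Theorems.FermatIsogenyBetaProductSectorStubDdStepCharts

/-!
# `BetaProductSector` (stmt-KontsevichZagierPeriods-3898), line `registered` (v3) — stub `stub_ddStep`,
# part 2: the two polynomial charts OUT OF the parameter surface `P`

Second part of the two-duplication move DD (see part 1, `…StubDdStepCharts`). On the parameter surface
`P = {(w,v) | 0 < w, w(1+w) < v(1-v)}` put `σ = 1+w-v`, `g = v(1-v) - w(1+w)` and `F = σ·g` (the pair
`(-w, v)` is a pair of roots of `X²(1-X)² = F·X + F·G/4`, `G = 4(w²(1+w)² + wF)/F`). This file supplies, in the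
format of `KZ.exists_dirichletPolarChart`, the two polynomial charts

* `DdStep.exists_chartPT`: `(w,v) ↦ (σ, g)` carries `P` injectively ONTO the lens `T = {0 < g < σ(1-σ)}`
  (`|det| = 2(v+w)`; inverse by the elementary symmetric functions of `(1+w, 1-v)`, one square root);
* `DdStep.exists_chartPM`: `(w,v) ↦ (v, F)` carries `P` injectively ONTO `M = {0<v<1, 0 < φ < v(1-v)²}`
  (`|det| = ∂F/∂(-w) = 3w² + 2(2-v)w + (1-v)²`; `w ↦ F(w,v)` is strictly decreasing, onto by the
  intermediate value theorem).

Everything is proved; no `def`, no named fact.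
-/

noncomputable section

open MeasureTheory Set
open Literature.ModelTheory.ExponentialFields (IsSemialgebraic)

namespace Summit.KontsevichZagierPeriods.FermatIsogeny.BetaProductSectorStubs

open Literature.NumberTheory.Transcendental
open Literature.NumberTheory.Transcendental.KZ

namespace DdStep

/-- On the parameter surface `P`, the second coordinate lies in `(0,1)` and exceeds the first. [folklore] -/
theorem regionP_bounds {z : Fin 2 → ℝ} (hz : 0 < z 0 ∧ z 0 * (1 + z 0) < z 1 * (1 - z 1)) :
    0 < z 1 ∧ z 1 < 1 ∧ z 0 < z 1 := by
  obtain ⟨h0, h1⟩ := hz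
  have hp : 0 < z 1 * (1 - z 1) := lt_trans (mul_pos h0 (by linarith)) h1
  have hz1 : 0 < z 1 := by nlinarith [sq_nonneg (z 1)]
  have hz1' : z 1 < 1 := by nlinarith
  refine ⟨hz1, hz1', ?_⟩
  nlinarith

/-! ## The chart `(w,v) ↦ (σ, g) = (1+w-v, v(1-v)-w(1+w))` of the lens by `P` -/

/-- **The chart `(w,v) ↦ (1+w-v, v(1-v)-w(1+w))`** of the lens `T = {0 < g < σ(1-σ)}` by the parameter surface
`P = {0 < w, w(1+w) < v(1-v)}`: a `ℚ`-polynomial map, differentiable with `|det| = 2(v+w)`, injective on `P` and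
ONTO `T` (inverse: `1+w` and `1-v` are the two roots of `X² - (σ+1)X + ((σ+1)² - (σ+1-g))/2`). [folklore] -/
theorem exists_chartPT :
    ∃ (Φ : (Fin 2 → ℝ) → (Fin 2 → ℝ)) (Φ' : (Fin 2 → ℝ) → (Fin 2 → ℝ) →L[ℝ] (Fin 2 → ℝ)),
      (∀ z, Φ z 0 = 1 + z 0 - z 1) ∧ (∀ z, Φ z 1 = z 1 * (1 - z 1) - z 0 * (1 + z 0)) ∧
      IsSemialgebraicMapOn ℚ {z : Fin 2 → ℝ | 0 < z 0 ∧ z 0 * (1 + z 0) < z 1 * (1 - z 1)} Φ ∧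
      (∀ z, HasFDerivAt Φ (Φ' z) z) ∧
      Set.InjOn Φ {z : Fin 2 → ℝ | 0 < z 0 ∧ z 0 * (1 + z 0) < z 1 * (1 - z 1)} ∧
      Φ '' {z : Fin 2 → ℝ | 0 < z 0 ∧ z 0 * (1 + z 0) < z 1 * (1 - z 1)} =
        {z : Fin 2 → ℝ | 0 < z 1 ∧ z 1 < z 0 * (1 - z 0)} ∧
      (∀ z ∈ {z : Fin 2 → ℝ | 0 < z 0 ∧ z 0 * (1 + z 0) < z 1 * (1 - z 1)},
        |(Φ' z).det| = 2 * (z 1 + z 0)) := by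
  set Φ : (Fin 2 → ℝ) → (Fin 2 → ℝ) := fun z => ![1 + z 0 - z 1, z 1 * (1 - z 1) - z 0 * (1 + z 0)] with hΦ
  set Φ' : (Fin 2 → ℝ) → (Fin 2 → ℝ) →L[ℝ] (Fin 2 → ℝ) :=
    fun z => LinearMap.toContinuousLinearMap (Matrix.toLin' !![1, -1; -(1 + 2 * z 0), 1 - 2 * z 1]) with hΦ'
  have hΦ0 : ∀ z, Φ z 0 = 1 + z 0 - z 1 := fun z => rfl
  have hΦ1 : ∀ z, Φ z 1 = z 1 * (1 - z 1) - z 0 * (1 + z 0) := fun z => rfl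
  have hΦ'0 : ∀ z v : Fin 2 → ℝ, Φ' z v 0 = v 0 - v 1 := by
    intro z v
    change Matrix.toLin' !![1, -1; -(1 + 2 * z 0), 1 - 2 * z 1] v 0 = _
    rw [Matrix.toLin'_apply]
    simp [Matrix.mulVec, dotProduct, Fin.sum_univ_two]
    ring
  have hΦ'1 : ∀ z v : Fin 2 → ℝ, Φ' z v 1 = -(1 + 2 * z 0) * v 0 + (1 - 2 * z 1) * v 1 := by
    intro z v
    change Matrix.toLin' !![1, -1; -(1 + 2 * z 0), 1 - 2 * z 1] v 1 = _
    rw [Matrix.toLin'_apply]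
    simp [Matrix.mulVec, dotProduct, Fin.sum_univ_two]
  have hdet : ∀ z, (Φ' z).det = -(2 * (z 1 + z 0)) := by
    intro z
    change LinearMap.det (Matrix.toLin' !![1, -1; -(1 + 2 * z 0), 1 - 2 * z 1]) = _
    rw [LinearMap.det_toLin', Matrix.det_fin_two]
    simp
    ring
  have hderiv : ∀ z, HasFDerivAt Φ (Φ' z) z := by
    intro z
    have h0 : HasFDerivAt (fun y : Fin 2 → ℝ => y 0)
        (ContinuousLinearMap.proj (R := ℝ) (φ := fun _ : Fin 2 => ℝ) 0) z := hasFDerivAt_apply 0 z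
    have h1 : HasFDerivAt (fun y : Fin 2 → ℝ => y 1)
        (ContinuousLinearMap.proj (R := ℝ) (φ := fun _ : Fin 2 => ℝ) 1) z := hasFDerivAt_apply 1 z
    rw [hasFDerivAt_pi']
    refine Fin.forall_fin_two.mpr ⟨?_, ?_⟩
    · have hf : (fun y : Fin 2 → ℝ => Φ y 0) = fun y => 1 + y 0 - y 1 := funext fun y => rfl
      rw [hf]
      refine ((h0.const_add 1).sub h1).congr_fderiv (ContinuousLinearMap.ext fun v => ?_)
      simp [hΦ'0]
    · have hf : (fun y : Fin 2 → ℝ => Φ y 1) = fun y => y 1 * (1 - y 1) - y 0 * (1 + y 0) :=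
        funext fun y => rfl
      rw [hf]
      refine ((h1.mul (h1.const_sub 1)).sub (h0.mul (h0.const_add 1))).congr_fderiv
        (ContinuousLinearMap.ext fun v => ?_)
      simp [hΦ'1]
      ring
  refine ⟨Φ, Φ', hΦ0, hΦ1, ?_, hderiv, ?_, ?_, fun z hz => ?_⟩
  · convert isSemialgebraicMapOn_aeval isSemialgebraic_regionP
      ![1 + MvPolynomial.X 0 - MvPolynomial.X 1,
        MvPolynomial.X 1 * (1 - MvPolynomial.X 1) - MvPolynomial.X 0 * (1 + MvPolynomial.X 0)] using 2 with z
    funext i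
    fin_cases i
    · simp [hΦ0]
    · simp [hΦ1]
  · intro x hx y hy hxy
    have e0 := congrFun hxy 0
    have e1 := congrFun hxy 1
    simp only [hΦ0, hΦ1] at e0 e1
    have hx1 := (regionP_bounds hx).1
    have hy1 := (regionP_bounds hy).1
    have key : (x 0 - y 0) * (x 0 + y 0 + x 1 + y 1) = 0 := by
      linear_combination (-1 : ℝ) * e1 - (1 - x 1 - y 1) * e0
    have hsum : 0 < x 0 + y 0 + x 1 + y 1 := by linarith [hx.1, hy.1]
    have h0 : x 0 = y 0 := by
      have := mul_eq_zero.1 key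
      rcases this with h | h
      · linarith
      · linarith
    funext i
    fin_cases i
    · exact h0
    · change x 1 = y 1
      linarith
  · ext y
    constructor
    · rintro ⟨z, hz, rfl⟩
      obtain ⟨hz1, hz1', hwv⟩ := regionP_bounds hz
      simp only [mem_setOf_eq, hΦ0, hΦ1]
      refine ⟨sub_pos.2 hz.2, ?_⟩
      nlinarith [mul_pos hz.1 hz1]
    · rintro ⟨hy1, hy2⟩
      have hy0 : 0 < y 0 := by nlinarith [sq_nonneg (y 0)]
      have hy0' : y 0 < 1 := by nlinarith
      have hD : (1 - y 0) ^ 2 < 1 - y 0 ^ 2 - 2 * y 1 := by nlinarith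
      have hD0 : 0 ≤ 1 - y 0 ^ 2 - 2 * y 1 := le_trans (sq_nonneg _) hD.le
      set r : ℝ := Real.sqrt (1 - y 0 ^ 2 - 2 * y 1) with hr
      have hr2 : r ^ 2 = 1 - y 0 ^ 2 - 2 * y 1 := Real.sq_sqrt hD0
      have hr1 : 1 - y 0 < r := by
        rw [hr, Real.lt_sqrt (by linarith)]
        exact hD
      refine ⟨![(y 0 - 1 + r) / 2, (1 - y 0 + r) / 2], ⟨?_, ?_⟩, ?_⟩
      · change 0 < (y 0 - 1 + r) / 2
        linarith
      · change (y 0 - 1 + r) / 2 * (1 + (y 0 - 1 + r) / 2) < (1 - y 0 + r) / 2 * (1 - (1 - y 0 + r) / 2)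
        nlinarith
      · funext i
        fin_cases i
        · change 1 + (y 0 - 1 + r) / 2 - (1 - y 0 + r) / 2 = y 0
          ring
        · change (1 - y 0 + r) / 2 * (1 - (1 - y 0 + r) / 2) - (y 0 - 1 + r) / 2 * (1 + (y 0 - 1 + r) / 2) = y 1
          nlinarith
  · rw [hdet, abs_neg, abs_of_pos]
    linarith [(regionP_bounds hz).1, hz.1]

/-! ## The chart `(w,v) ↦ (v, F) = (v, (1+w-v)(v(1-v)-w(1+w)))` of `M` by `P` -/

/-- `F(w,v) = (1+w-v)(v(1-v)-w(1+w))` is strictly decreasing in `w ≥ 0` (for `v < 1`): the difference quotient is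
minus a positive quantity. [folklore] -/
theorem quarticF_sub_quarticF (w w' v : ℝ) :
    (1 + w - v) * (v * (1 - v) - w * (1 + w)) - (1 + w' - v) * (v * (1 - v) - w' * (1 + w')) =
      -((w - w') * ((1 - v) ^ 2 + (2 - v) * (w + w') + (w ^ 2 + w * w' + w' ^ 2))) := by
  ring

/-- **The chart `(w,v) ↦ (v, (1+w-v)(v(1-v)-w(1+w)))`** of `M = {0<v<1, 0 < φ < v(1-v)²}` by the parameter surface
`P = {0 < w, w(1+w) < v(1-v)}`: a `ℚ`-polynomial map, differentiable with `|det| = 3w² + 2(2-v)w + (1-v)²`,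
injective on `P` (strict monotonicity of `w ↦ F(w,v)`) and ONTO `M` (intermediate value theorem in `w ∈ (0,1)`:
`F(0,v) = v(1-v)² > φ > 0 > F(1,v)`). [folklore] -/
theorem exists_chartPM : ∃ (Φ : (Fin 2 → ℝ) → (Fin 2 → ℝ)) (Φ' : (Fin 2 → ℝ) → (Fin 2 → ℝ) →L[ℝ] (Fin 2 → ℝ)), (∀ z, Φ z 0 = z 1) ∧ (∀ z, Φ z 1 = (1 + z 0 - z 1) * (z 1 * (1 - z 1) - z 0 * (1 + z 0))) ∧ Literature.NumberTheory.Transcendental.IsSemialgebraicMapOn ℚ {z : Fin 2 → ℝ | 0 < z 0 ∧ z 0 * (1 + z 0) < z 1 * (1 - z 1)} Φ ∧ (∀ z, HasFDerivAt Φ (Φ' z) z) ∧ Set.InjOn Φ {z : Fin 2 → ℝ | 0 < z 0 ∧ z 0 * (1 + z 0) < z 1 * (1 - z 1)} ∧ Φ '' {z : Fin 2 → ℝ | 0 < z 0 ∧ z 0 * (1 + z 0) < z 1 * (1 - z 1)} = {z : Fin 2 → ℝ | 0 < z 0 ∧ z 0 < 1 ∧ 0 < z 1 ∧ z 1 < z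 0 * (1 - z 0) ^ 2} ∧ (∀ z ∈ {z : Fin 2 → ℝ | 0 < z 0 ∧ z 0 * (1 + z 0) < z 1 * (1 - z 1)}, |(Φ' z).det| = 3 * z 0 ^ 2 + 2 * (2 - z 1) * z 0 + (1 - z 1) ^ 2) := by
  set Φ : (Fin 2 → ℝ) → (Fin 2 → ℝ) :=
    fun z => ![z 1, (1 + z 0 - z 1) * (z 1 * (1 - z 1) - z 0 * (1 + z 0))] with hΦ
  set Φ' : (Fin 2 → ℝ) → (Fin 2 → ℝ) →L[ℝ] (Fin 2 → ℝ) :=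
    fun z => LinearMap.toContinuousLinearMap (Matrix.toLin'
      !![0, 1; -(3 * z 0 ^ 2 + 2 * (2 - z 1) * z 0 + (1 - z 1) ^ 2),
        3 * z 1 ^ 2 - 2 * (2 + z 0) * z 1 + (1 + z 0) ^ 2]) with hΦ'
  have hΦ0 : ∀ z, Φ z 0 = z 1 := fun z => rfl
  have hΦ1 : ∀ z, Φ z 1 = (1 + z 0 - z 1) * (z 1 * (1 - z 1) - z 0 * (1 + z 0)) := fun z => rfl
  have hΦ'0 : ∀ z v : Fin 2 → ℝ, Φ' z v 0 = v 1 := by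
    intro z v
    change Matrix.toLin' !![0, 1; -(3 * z 0 ^ 2 + 2 * (2 - z 1) * z 0 + (1 - z 1) ^ 2),
      3 * z 1 ^ 2 - 2 * (2 + z 0) * z 1 + (1 + z 0) ^ 2] v 0 = _
    rw [Matrix.toLin'_apply]
    simp [Matrix.mulVec, dotProduct, Fin.sum_univ_two]
  have hΦ'1 : ∀ z v : Fin 2 → ℝ, Φ' z v 1 = -(3 * z 0 ^ 2 + 2 * (2 - z 1) * z 0 + (1 - z 1) ^ 2) * v 0 +
      (3 * z 1 ^ 2 - 2 * (2 + z 0) * z 1 + (1 + z 0) ^ 2) * v 1 := by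
    intro z v
    change Matrix.toLin' !![0, 1; -(3 * z 0 ^ 2 + 2 * (2 - z 1) * z 0 + (1 - z 1) ^ 2),
      3 * z 1 ^ 2 - 2 * (2 + z 0) * z 1 + (1 + z 0) ^ 2] v 1 = _
    rw [Matrix.toLin'_apply]
    simp [Matrix.mulVec, dotProduct, Fin.sum_univ_two]
  have hdet : ∀ z, (Φ' z).det = 3 * z 0 ^ 2 + 2 * (2 - z 1) * z 0 + (1 - z 1) ^ 2 := by
    intro z
    change LinearMap.det (Matrix.toLin' !![0, 1; -(3 * z 0 ^ 2 + 2 * (2 - z 1) * z 0 + (1 - z 1) ^ 2),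
      3 * z 1 ^ 2 - 2 * (2 + z 0) * z 1 + (1 + z 0) ^ 2]) = _
    rw [LinearMap.det_toLin', Matrix.det_fin_two]
    simp
  have hderiv : ∀ z, HasFDerivAt Φ (Φ' z) z := by
    intro z
    have h0 : HasFDerivAt (fun y : Fin 2 → ℝ => y 0)
        (ContinuousLinearMap.proj (R := ℝ) (φ := fun _ : Fin 2 => ℝ) 0) z := hasFDerivAt_apply 0 z
    have h1 : HasFDerivAt (fun y : Fin 2 → ℝ => y 1)
        (ContinuousLinearMap.proj (R := ℝ) (φ := fun _ : Fin 2 => ℝ) 1) z := hasFDerivAt_apply 1 z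
    rw [hasFDerivAt_pi']
    refine Fin.forall_fin_two.mpr ⟨?_, ?_⟩
    · have hf : (fun y : Fin 2 → ℝ => Φ y 0) = fun y => y 1 := funext fun y => rfl
      rw [hf]
      refine h1.congr_fderiv (ContinuousLinearMap.ext fun v => ?_)
      simp [hΦ'0]
    · have hf : (fun y : Fin 2 → ℝ => Φ y 1) =
          fun y => (1 + y 0 - y 1) * (y 1 * (1 - y 1) - y 0 * (1 + y 0)) := funext fun y => rfl
      rw [hf]
      refine (((h0.const_add 1).sub h1).mul ((h1.mul (h1.const_sub 1)).sub (h0.mul (h0.const_add 1)))).congr_fderiv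
        (ContinuousLinearMap.ext fun v => ?_)
      simp [hΦ'1]
      ring
  refine ⟨Φ, Φ', hΦ0, hΦ1, ?_, hderiv, ?_, ?_, fun z hz => ?_⟩
  · convert isSemialgebraicMapOn_aeval isSemialgebraic_regionP
      ![MvPolynomial.X 1, (1 + MvPolynomial.X 0 - MvPolynomial.X 1) *
        (MvPolynomial.X 1 * (1 - MvPolynomial.X 1) - MvPolynomial.X 0 * (1 + MvPolynomial.X 0))] using 2 with z
    funext i
    fin_cases i
    · simp [hΦ0]
    · simp [hΦ1]
  · intro x hx y hy hxy
    have e0 := congrFun hxy 0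
    have e1 := congrFun hxy 1
    simp only [hΦ0, hΦ1] at e0 e1
    have hy1' := (regionP_bounds hy).2.1
    rw [e0] at e1
    have key := quarticF_sub_quarticF (x 0) (y 0) (y 1)
    rw [e1, sub_self] at key
    have hpos : 0 < (1 - y 1) ^ 2 + (2 - y 1) * (x 0 + y 0) + (x 0 ^ 2 + x 0 * y 0 + y 0 ^ 2) := by
      have h1 : 0 < 1 - y 1 := sub_pos.2 hy1'
      nlinarith [mul_pos hx.1 hy.1, hx.1, hy.1, pow_pos h1 2, sq_nonneg (x 0), sq_nonneg (y 0)]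
    have h0 : x 0 = y 0 := by
      have h := (neg_eq_zero.1 key.symm)
      rcases mul_eq_zero.1 h with h | h
      · linarith
      · linarith
    funext i
    fin_cases i
    · exact h0
    · exact e0
  · ext y
    constructor
    · rintro ⟨z, hz, rfl⟩
      obtain ⟨hz1, hz1', hwv⟩ := regionP_bounds hz
      simp only [mem_setOf_eq, hΦ0, hΦ1]
      refine ⟨hz1, hz1', mul_pos (by linarith [hz.1]) (sub_pos.2 hz.2), ?_⟩
      have e : z 1 * (1 - z 1) ^ 2 - (1 + z 0 - z 1) * (z 1 * (1 - z 1) - z 0 * (1 + z 0)) =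
          z 0 * ((1 - z 1) ^ 2 + z 0 * (2 - z 1) + z 0 ^ 2) := by ring
      have hp : 0 < z 0 * ((1 - z 1) ^ 2 + z 0 * (2 - z 1) + z 0 ^ 2) := by
        have h1 : 0 < 1 - z 1 := sub_pos.2 hz1'
        refine mul_pos hz.1 ?_
        nlinarith [hz.1, pow_pos h1 2, sq_nonneg (z 0)]
      linarith
    · rintro ⟨hy0, hy0', hy1, hy2⟩
      -- intermediate value theorem for `w ↦ F(w, y 0)` on `[0, 1]`
      set f : ℝ → ℝ := fun w => (1 + w - y 0) * (y 0 * (1 - y 0) - w * (1 + w)) with hf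
      have hfc : ContinuousOn f (Set.Icc 0 1) := by
        apply Continuous.continuousOn
        rw [hf]
        fun_prop
      have hf0 : f 0 = y 0 * (1 - y 0) ^ 2 := by rw [hf]; ring
      have hf1 : f 1 < 0 := by
        have e : f 1 = y 0 * (1 - y 0) ^ 2 - (1 - y 0) ^ 2 - (2 - y 0) - 1 := by rw [hf]; ring
        rw [e]
        nlinarith [pow_pos (sub_pos.2 hy0') 2]
      have hmem : y 1 ∈ Set.Ioo (f 1) (f 0) := ⟨by linarith, by rw [hf0]; exact hy2⟩
      obtain ⟨w, ⟨hw0, hw1⟩, hw⟩ := intermediate_value_Ioo' zero_le_one hfc hmem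
      have hg : 0 < y 0 * (1 - y 0) - w * (1 + w) := by
        have hF : 0 < (1 + w - y 0) * (y 0 * (1 - y 0) - w * (1 + w)) := by
          have : f w = y 1 := hw
          rw [hf] at this
          simp only at this
          linarith
        rcases pos_and_pos_or_neg_and_neg_of_mul_pos hF with ⟨_, h⟩ | ⟨h, _⟩
        · exact h
        · linarith
      refine ⟨![w, y 0], ⟨?_, ?_⟩, ?_⟩
      · change 0 < w
        exact hw0
      · change w * (1 + w) < y 0 * (1 - y 0)
        linarith
      · funext i
        fin_cases i
        · rfl
        · exact hw
  · rw [hdet, abs_of_pos]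
    have h1 : 0 < 1 - z 1 := sub_pos.2 (regionP_bounds hz).2.1
    nlinarith [hz.1, pow_pos h1 2, sq_nonneg (z 0), mul_pos hz.1 h1]

end DdStep

end Summit.KontsevichZagierPeriods.FermatIsogeny.BetaProductSectorStubs

end
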